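import Summits.ResolutionOfSingularities.ResolutionOfSingularities.Theorems.EquisingularLiftEquisingularLiftNatHyperplaneLetter
import Summits.ResolutionOfSingularities.ResolutionOfSingularities.Theorems.EquisingularLiftEquisingularLiftNatLinearFormSectionLift
import Literature.AlgebraicGeometry.Motives.GeneratingSectionsOfHomAppLE
import Literature.AlgebraicGeometry.Smoothening.LocalPoints
import HarnessLib

/-!
# [OURS · L1 W4.5(b) · EL♮(3) · T23-A⁗ (F4)] HYPERPLANE LETTERS OVER `O`, part 4 — THROUGH THE SECTION ((L2), fork (α)):
# coordinates of an `O`-point of `ℙ_O`, `V₊(ℓ̃) ∋ s ⟸ ℓ̃(a) = 0`, and ★ `exists_letter_model_le_ker`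

res-type-027 g19 (FREE NAMED-RESERVE prover of chain w45b; desk DEAL 2026-08-28T12:35:57Z «027 … (H3) `…NatHyperplaneLetterThroughSection`
((L2)(α) scheme dress over stub-2's algebra)»; res-L1-w45b-stub-4 `T23A4-ENGINE-WORD-v2.md` FINAL 81913c484db62a21 §1/§3 (L2)). Crux
`EquisingularLiftNatThree` = stmt-ResolutionOfSingularities-20148 (parent stmt-…-20038), route `EquisingularLift`, line `sections`. OURS; NOT a statement
of any manuscript ([Hironaka2017] is a candidate under adjudication, nothing of it is asserted); AI-written, weaker than expert review. No `sorry`, no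
definition, no instance; standard axioms. `--supports stmt-ResolutionOfSingularities-20148 --as helper`.

WHAT. The A⁗ seed needs, for a letter `V₊(ℓ) ∋ x₀` offered DOWNSTAIRS and the driver's section `s : Spec O → ℙ_O` through `g x₀` (K5″, res-L1-w45b-stub-2
p634794), an UPSTAIRS model `Λ = V₊(ℓ̃)` with the five `LetterDatum` clauses (part 3) AND `Λ ≤ ker s` (the section lies in the letter, so that the strict
transform under the section blow-up has trace `St_{x₀} V₊(ℓ)`). This file supplies the scheme dress around res-L1-w45b-stub-2's algebra
(`LetterLift.exists_lift_sum_mul_eq_zero`, …NatLinearFormSectionLift p634533), WITHOUT `Proj`-stalk internals: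
* `exists_chart_of_section` — some standard chart `D₊(x_{i₀})` contains the whole section (`Smoothening.range_subset_of_closedPoint_mem`);
* `exists_sectionPull` — the COORDINATE ring homomorphism `Φ : (O[x]_{x_{i₀}})₀ → Γ(Spec O, ⊤)` of the section on that chart: `Φ = s^* ∘ awayToSection`
  (Literature `Motives.GeneratingSections.topIso_hom_pull_chartLift`) and `Φ ∘ cst = ΓSpecIso⁻¹` (from `s ≫ q = 𝟙` and `Motives.Segre.chartι_toSpec`);
* `sectionPull_awayMk` — **dehomogenisation = evaluation**: `Φ (G / x_{i₀}) = ΓSpecIso⁻¹ (eval a G)` for the coordinates `a_j := ΓSpecIso (Φ (x_j/x_{i₀}))`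
  (`Motives.Segre.awayMk_eq_eval₂`), with `a_{i₀} = 1`;
* `ker_projMap_le_ker_of_eval_eq_zero` — **`V₊(G) ∋ s ⟸ G(a) = 0`**: `ker (Proj f) ≤ ker s` when `ker f = (G)`, `G` a linear form with `eval a G = 0`
  (pull-back to `Spec O` is `(Φ (G/x_{i₀})) = 0`);
* `eval_mem_maximalIdeal_of_mem_support` — conversely, if `s(𝔪) ∈ supp ker (Proj f)` then `G(a) ∈ 𝔪_O`;
* ★ `exists_letter_model_le_ker` — for `s` through `g x₀`, `ℓ ∈ k[x]₁`, `ℓ ≠ 0`, `ℓ ∈ 𝔭_{x₀}`, `H ⊄ V₊(ℓ)`: a graded substitution `f_O` with `ker f_O = (ℓ̃)`,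
  `map π ℓ̃ = ℓ`, the five `LetterDatum` clauses of `ker (Proj f_O)` with trace `{y | ℓ ∈ 𝔭_y}` (part 3 `exists_hyperplane_model`), AND `ker (Proj f_O) ≤ ker s`.

References: [Hartshorne1977, II Prop. 2.5, Thm. 7.1 (a), Ex. 3.12 (a)]; parts 1–3, R1 `…NatLinearCentre*`, res-L1-w45b-stub-2 `…NatLinearFormSectionLift`
(OURS, imported); Literature `Motives/ProjectiveOfGeneratingSections`, `Motives/SegreEmbedding` (charts, `pull`, `cst`, `frac`).
-/

set_option linter.dupNamespace false -- mandated namespace `Summit.<Summit>.<Problem>` of this single-conjunct summit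
set_option linter.overlappingInstances false -- signatures carry `[IsDomain O] [IsDiscreteValuationRing O]`

noncomputable section

open CategoryTheory CategoryTheory.Limits AlgebraicGeometry TopologicalSpace Opposite
open MvPolynomial HomogeneousLocalization
open Literature.AlgebraicGeometry.Resolution
open Literature.AlgebraicGeometry.Motives Literature.AlgebraicGeometry.Motives.Segre Literature.AlgebraicGeometry.Motives.GeneratingSections
open AlgebraicGeometry.Scheme.IdealSheafData
open Summit.ResolutionOfSingularities.ResolutionOfSingularities.Cruxes.EquisingularLift.StrataSplit

attribute [local instance] MvPolynomial.gradedAlgebra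

namespace Summit.ResolutionOfSingularities.ResolutionOfSingularities.Cruxes.EquisingularLiftNat

namespace LinearLetter

/-! ## A chart containing the section; the coordinate homomorphism of the section -/

section SectionCoords

variable {O : Type} [CommRing O] {N : ℕ} (s : Spec (.of O) ⟶ Proj (homogeneousSubmodule (Fin (N + 1)) O))

/-- **Some standard chart `D₊(x_{i₀})` contains the whole section** (`O` local): the closed point lands in some `D₊(x_{i₀})`, and every point of
`Spec O` specialises to it. [folklore] -/
theorem exists_chart_of_section [IsLocalRing O] :
    ∃ i₀ : Fin (N + 1), (⊤ : (Spec (.of O)).Opens) ≤ preU s i₀ := by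
  have hcov := iSup_preU s
  have hmem : IsLocalRing.closedPoint O ∈ (⨆ i, preU s i) := by rw [hcov]; trivial
  obtain ⟨i₀, hi₀⟩ := Opens.mem_iSup.mp hmem
  refine ⟨i₀, fun y _ => ?_⟩
  exact Literature.AlgebraicGeometry.Smoothening.range_subset_of_closedPoint_mem s
    (Proj.basicOpen (homogeneousSubmodule (Fin (N + 1)) O) (X i₀)).isOpen hi₀ ⟨y, rfl⟩

variable (i₀ : Fin (N + 1)) (htop : (⊤ : (Spec (.of O)).Opens) ≤ preU s i₀)

/-- **The coordinate homomorphism of the section on the chart `D₊(x_{i₀})`.** There is a ring homomorphism `Φ : (O[x]_{x_{i₀}})₀ → Γ(Spec O, ⊤)` with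
`s^*(awayToSection c) = Φ c` (the section pulls chart functions back through `Φ`) and, when `s` is a section of `q : ℙ_O → Spec O`, `Φ (cst c) = ΓSpecIso⁻¹ c`
(it is `O`-linear). It is the restriction to `⊤ = s⁻¹ D₊(x_{i₀})` of `pull (chartLift s i₀)` (Literature `GeneratingSections`). [folklore] -/
theorem exists_sectionPull
    (hs : s ≫ (Proj.toSpecZero (homogeneousSubmodule (Fin (N + 1)) O) ≫
      Spec.map (CommRingCat.ofHom (algebraMap O ((homogeneousSubmodule (Fin (N + 1)) O) 0)))) = 𝟙 _) :
    ∃ Φ : Away (homogeneousSubmodule (Fin (N + 1)) O) (X i₀) →+* Γ(Spec (.of O), ⊤),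
      (∀ c, s.appLE (Proj.basicOpen (homogeneousSubmodule (Fin (N + 1)) O) (X i₀)) ⊤ htop
          (Proj.awayToSection (homogeneousSubmodule (Fin (N + 1)) O) (X i₀) c) = Φ c) ∧
      (∀ c : O, Φ (cst O (X i₀) c) = (Scheme.ΓSpecIso (.of O)).inv c) := by
  let ρ : Γ(Spec (.of O), preU s i₀) →+* Γ(Spec (.of O), ⊤) := ((Spec (.of O)).presheaf.map (homOfLE htop).op).hom
  let τ : Γ(↑(preU s i₀), ⊤) →+* Γ(Spec (.of O), preU s i₀) := (preU s i₀).topIso.hom.hom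
  refine ⟨(ρ.comp τ).comp (pull (chartLift s i₀)), fun c => ?_, fun c => ?_⟩
  · -- `s^* = restrict ∘ s^*|_{preU}` and `topIso_hom_pull_chartLift`
    have h := topIso_hom_pull_chartLift s i₀ c
    have hmap := Scheme.Hom.appLE_map s (U := Proj.basicOpen (homogeneousSubmodule (Fin (N + 1)) O) (X i₀))
      (V := preU s i₀) le_rfl (homOfLE htop).op
    rw [← hmap]
    change ρ (s.appLE _ (preU s i₀) le_rfl (Proj.awayToSection (homogeneousSubmodule (Fin (N + 1)) O) (X i₀) c)) =
      ρ (τ (pull (chartLift s i₀) c))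
    rw [← h]
  · -- `chartLift ≫ Spec (cst) = (preU).ι ≫ s ≫ q = (preU).ι`
    have hmor : chartLift s i₀ ≫ Spec.map (CommRingCat.ofHom (cst O (X i₀))) = (preU s i₀).ι := by
      rw [← chartι_toSpec, chartLift_chartι_assoc]
      change (preU s i₀).ι ≫ s ≫ (Proj.toSpecZero (homogeneousSubmodule (Fin (N + 1)) O) ≫
        Spec.map (CommRingCat.ofHom (algebraMap O ((homogeneousSubmodule (Fin (N + 1)) O) 0)))) = _
      rw [hs, Category.comp_id]
    have hpull : pull (chartLift s i₀) (cst O (X i₀) c) = pull (preU s i₀).ι c := by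
      rw [← hmor, pull_SpecMap']
      rfl
    change ρ (τ (pull (chartLift s i₀) (cst O (X i₀) c))) = _
    rw [hpull, pull_apply]
    -- three presheaf maps compose to the identity
    simp only [ρ, τ, Scheme.Opens.ι_appTop, Scheme.Opens.topIso_hom]
    change ((Spec (.of O)).presheaf.map _ ≫ (Spec (.of O)).presheaf.map _ ≫ (Spec (.of O)).presheaf.map _).hom
      ((Scheme.ΓSpecIso (.of O)).inv c) = _
    rw [← Functor.map_comp, ← Functor.map_comp]
    refine (congrArg (fun g => ((Spec (.of O)).presheaf.map g).hom ((Scheme.ΓSpecIso (.of O)).inv c))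
      (Quiver.Hom.unop_inj (Subsingleton.elim _ _) : _ = 𝟙 _)).trans ?_
    rw [CategoryTheory.Functor.map_id]
    rfl

end SectionCoords

/-! ## Dehomogenisation along the section = evaluation at its coordinates -/

section Eval

variable {O : Type} [CommRing O] {N : ℕ} (i₀ : Fin (N + 1))
  (Φ : Away (homogeneousSubmodule (Fin (N + 1)) O) (X i₀) →+* Γ(Spec (.of O), ⊤))
  (hΦcst : ∀ c : O, Φ (cst O (X i₀) c) = (Scheme.ΓSpecIso (.of O)).inv c)

include hΦcst in
/-- **Dehomogenisation = evaluation at the coordinates**: for the coordinates `a_j := ΓSpecIso (Φ (x_j / x_{i₀}))` of the section and a form `G` of degree `n`,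
`Φ (G / x_{i₀}ⁿ) = ΓSpecIso⁻¹ (G(a))` (`Motives.Segre.awayMk_eq_eval₂`). [folklore] -/
theorem sectionPull_awayMk (n : ℕ) (G : MvPolynomial (Fin (N + 1)) O) (hG : G ∈ homogeneousSubmodule (Fin (N + 1)) O (n • 1)) :
    Φ (Away.mk (homogeneousSubmodule (Fin (N + 1)) O) (X_mem O i₀) n G hG) =
      (Scheme.ΓSpecIso (.of O)).inv
        (MvPolynomial.eval (fun j => (Scheme.ΓSpecIso (.of O)).hom (Φ (frac O i₀ j))) G) := by
  rw [awayMk_eq_eval₂, map_eval₂Hom]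
  have hf : Φ.comp (cst O (X i₀)) = (Scheme.ΓSpecIso (.of O)).inv.hom := RingHom.ext fun c => hΦcst c
  have hg : (fun j => Φ (frac O i₀ j)) =
      fun j => (Scheme.ΓSpecIso (.of O)).inv.hom ((Scheme.ΓSpecIso (.of O)).hom (Φ (frac O i₀ j))) := by
    funext j
    exact (Iso.hom_inv_id_apply (Scheme.ΓSpecIso (.of O)) _).symm
  rw [hf, hg]
  have key := map_eval₂Hom (RingHom.id O) (fun j => (Scheme.ΓSpecIso (.of O)).hom (Φ (frac O i₀ j)))
    (Scheme.ΓSpecIso (.of O)).inv.hom G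
  rw [RingHom.comp_id] at key
  exact key.symm

/-- The `i₀`-th coordinate is `1` (`x_{i₀}/x_{i₀} = 1`). [folklore] -/
theorem coord_self : (Scheme.ΓSpecIso (.of O)).hom (Φ (frac O i₀ i₀)) = 1 := by
  rw [frac_self, map_one, map_one]

end Eval

/-! ## `V₊(G) ∋ s ⟸ G(a) = 0`, and the converse at the closed point -/

section LeKer

variable {O : Type} [CommRing O] {N r : ℕ} (e : Fin (r + 1) → Fin (N + 1))
  (fO : (homogeneousSubmodule (Fin (N + 1)) O) →+*ᵍ (homogeneousSubmodule (Fin (r + 1)) O))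
  (hfO' : HomogeneousIdeal.irrelevant (homogeneousSubmodule (Fin (r + 1)) O) ≤
    (HomogeneousIdeal.irrelevant (homogeneousSubmodule (Fin (N + 1)) O)).map fO)
  (hfOC : ∀ b : O, fO (C b) = C b) (hfOe : ∀ j : Fin (r + 1), fO (X (e j)) = X j)
  (s : Spec (.of O) ⟶ Proj (homogeneousSubmodule (Fin (N + 1)) O)) (i₀ : Fin (N + 1))
  (htop : (⊤ : (Spec (.of O)).Opens) ≤ preU s i₀)
  (Φ : Away (homogeneousSubmodule (Fin (N + 1)) O) (X i₀) →+* Γ(Spec (.of O), ⊤))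
  (hΦs : ∀ c, s.appLE (Proj.basicOpen (homogeneousSubmodule (Fin (N + 1)) O) (X i₀)) ⊤ htop
    (Proj.awayToSection (homogeneousSubmodule (Fin (N + 1)) O) (X i₀) c) = Φ c)
  (hΦcst : ∀ c : O, Φ (cst O (X i₀) c) = (Scheme.ΓSpecIso (.of O)).inv c)

include hfOC hfOe in
/-- The ideal of sections of `ker (Proj f)` over `D₊(x_{i₀})` is `(G / x_{i₀})` when `ker f = (G)`, `G` a linear form (part 2's chart computation, stated).
[cite: Hartshorne1977, II Prop. 5.9 and Ex. 3.12 (a)] -/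
theorem ideal_ker_basicOpen_eq_span {G : MvPolynomial (Fin (N + 1)) O} (hG : G.IsHomogeneous 1)
    (hker : RingHom.ker fO = Ideal.span {G}) :
    (Proj.map fO hfO').ker.ideal ⟨Proj.basicOpen (homogeneousSubmodule (Fin (N + 1)) O) (X i₀),
        Proj.isAffineOpen_basicOpen _ (X i₀) (X_mem O i₀) one_pos⟩ =
      Ideal.span {Proj.awayToSection (homogeneousSubmodule (Fin (N + 1)) O) (X i₀)
        (Away.mk (homogeneousSubmodule (Fin (N + 1)) O) (X_mem O i₀) 1 G (by simpa using hG))} := by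
  have hsurj : Function.Surjective fO := subst_surjective e fO.toRingHom (fun b => hfOC b) (fun j => hfOe j)
  have hgm : G ∈ (homogeneousSubmodule (Fin (N + 1)) O) 1 := hG
  have hspan : awayIdeal (homogeneousSubmodule (Fin (N + 1)) O) (X_mem O i₀) (Ideal.span {G}) =
      Ideal.span {mk₁ (homogeneousSubmodule (Fin (N + 1)) O) (X_mem O i₀) 1 G hgm} := by
    have h := awayIdeal_span_eq (homogeneousSubmodule (Fin (N + 1)) O) (X_mem O i₀) (fun _ : Unit => G) (fun _ => 1)
      (fun _ => hgm)
    simp only [Set.range_const] at h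
    exact h
  rw [ker_projMap_ideal_basicOpen fO hfO' hsurj one_pos (X_mem O i₀), hker, hspan, Ideal.map_span, Set.image_singleton]
  rfl

include hfOC hfOe hΦs hΦcst in
/-- **`V₊(G) ∋ s ⟸ G(a) = 0`**: if `ker f = (G)` for a linear form `G` vanishing at the coordinates `a` of the section, then `ker (Proj f) ≤ ker s` (the
pull-back of `ker (Proj f)` to `Spec O` is generated by `Φ (G / x_{i₀}) = ΓSpecIso⁻¹ (G(a)) = 0`). [folklore] -/
theorem ker_projMap_le_ker_of_eval_eq_zero {G : MvPolynomial (Fin (N + 1)) O} (hG : G.IsHomogeneous 1)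
    (hker : RingHom.ker fO = Ideal.span {G})
    (heval : MvPolynomial.eval (fun j => (Scheme.ΓSpecIso (.of O)).hom (Φ (frac O i₀ j))) G = 0) :
    (Proj.map fO hfO').ker ≤ s.ker := by
  -- `K ≤ ker s ↔ K.comap s = ⊥`
  rw [← Scheme.IdealSheafData.map_bot s, Scheme.IdealSheafData.le_map_iff_comap_le, le_bot_iff]
  -- on the affine cover `{⊤}` of `Spec O`
  let V : (Spec (.of O)).affineOpens := ⟨⊤, isAffineOpen_top (Spec (.of O))⟩
  have hV : ⨆ _ : Unit, (V : (Spec (.of O)).Opens) = ⊤ := by simp [V]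
  refine le_bot_iff.mp (le_of_iSup_eq_top (fun _ : Unit => V) hV fun _ => ?_)
  rw [Scheme.IdealSheafData.ideal_bot, Pi.bot_apply, le_bot_iff,
    ideal_comap_of_le s (Proj.map fO hfO').ker ⟨Proj.basicOpen (homogeneousSubmodule (Fin (N + 1)) O) (X i₀),
      Proj.isAffineOpen_basicOpen _ (X i₀) (X_mem O i₀) one_pos⟩ V htop,
    ideal_ker_basicOpen_eq_span e fO hfO' hfOC hfOe i₀ hG hker, Ideal.map_span, Set.image_singleton, Ideal.span_singleton_eq_bot]
  change s.appLE _ ⊤ htop _ = 0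
  rw [hΦs, sectionPull_awayMk i₀ Φ hΦcst 1 G, heval, map_zero]

include hfOC hfOe hΦs hΦcst in
/-- **Conversely, at the closed point**: if `s(𝔪) ∈ supp ker (Proj f)` (the section's closed point lies on `V₊(G)`) then `G(a) ∈ 𝔪_O`. [folklore] -/
theorem eval_mem_maximalIdeal_of_mem_support [IsLocalRing O] {G : MvPolynomial (Fin (N + 1)) O} (hG : G.IsHomogeneous 1)
    (hker : RingHom.ker fO = Ideal.span {G})
    (hmem : s (IsLocalRing.closedPoint O) ∈ ((Proj.map fO hfO').ker.support : Set (Proj (homogeneousSubmodule (Fin (N + 1)) O)))) :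
    MvPolynomial.eval (fun j => (Scheme.ΓSpecIso (.of O)).hom (Φ (frac O i₀ j))) G ∈ IsLocalRing.maximalIdeal O := by
  let V : (Spec (.of O)).affineOpens := ⟨⊤, isAffineOpen_top (Spec (.of O))⟩
  set xm : Spec (.of O) := IsLocalRing.closedPoint O with hxm
  have hmem' : xm ∈ ((Proj.map fO hfO').ker.comap s).support := by
    rw [Scheme.IdealSheafData.support_comap]
    exact hmem
  have hz := (Scheme.IdealSheafData.mem_support_iff_of_mem (I := (Proj.map fO hfO').ker.comap s) (x := xm) (U := V)
    (Set.mem_univ _)).mp hmem'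
  rw [ideal_comap_of_le s (Proj.map fO hfO').ker ⟨Proj.basicOpen (homogeneousSubmodule (Fin (N + 1)) O) (X i₀),
      Proj.isAffineOpen_basicOpen _ (X i₀) (X_mem O i₀) one_pos⟩ V htop,
    ideal_ker_basicOpen_eq_span e fO hfO' hfOC hfOe i₀ hG hker, Ideal.map_span, Set.image_singleton] at hz
  have h := (Scheme.mem_zeroLocus_iff _ _ _).mp hz _ (Ideal.mem_span_singleton_self _)
  change xm ∉ (Spec (.of O)).basicOpen (s.appLE _ ⊤ htop _) at h
  rw [hΦs, sectionPull_awayMk i₀ Φ hΦcst 1 G, basicOpen_eq_of_affine] at h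
  by_contra hne
  exact h (hxm ▸ hne)

end LeKer

/-! ## ★ The letter model through the section -/

section Main

variable {O k : Type} [CommRing O] [IsDomain O] [IsDiscreteValuationRing O] [Field k] (π : O →+* k)
  (hπ : Function.Surjective π) {r : ℕ}
  (φ : (homogeneousSubmodule (Fin (r + 1 + 1)) O) →+*ᵍ (homogeneousSubmodule (Fin (r + 1 + 1)) k))
  (hφ : ∀ q, φ q = MvPolynomial.map π q)
  (hφ' : HomogeneousIdeal.irrelevant (homogeneousSubmodule (Fin (r + 1 + 1)) k) ≤
    (HomogeneousIdeal.irrelevant (homogeneousSubmodule (Fin (r + 1 + 1)) O)).map φ)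

/-- The kernel of a surjection from a local ring onto a field is the maximal ideal. [folklore] -/
theorem ker_eq_maximalIdeal_of_surjective {O k : Type} [CommRing O] [IsLocalRing O] [Field k] (π : O →+* k)
    (hπ : Function.Surjective π) : RingHom.ker π = IsLocalRing.maximalIdeal O :=
  IsLocalRing.eq_maximalIdeal (RingHom.ker_isMaximal_of_surjective π hπ)

include hπ hφ in
/-- ★ **THE LETTER MODEL THROUGH THE SECTION** ((L2), fork (α) of res-L1-w45b-stub-4's ENGINE WORD v2). In the EL♮ ambient `P = ℙ^{r+1}_O → Spec O` with special
fibre `g = Proj φ : ℙ_k → ℙ_O`, let `s` be a section of `q` through `g x₀` and `ℓ ∈ k[x]` a non-zero linear form with `x₀ ∈ V₊(ℓ) = {y | ℓ ∈ 𝔭_y}` and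
`H ⊄ V₊(ℓ)`. Then there is a graded substitution `f_O` (constants fixed, section `rename (a.succAbove)`) whose `Λ := ker (Proj f_O)` — a hyperplane `V₊(ℓ̃)`,
`ℓ̃ = Σ c_j x_j` with `map π ℓ̃ = ℓ` — has the five `LetterDatum` clauses at the initial stage with trace `{y | ℓ ∈ 𝔭_y}` (part 3) AND CONTAINS THE SECTION:
`Λ ≤ ker s`. (Coordinates of `s` on a chart `D₊(x_{i₀})`; `x₀ ∈ V₊(ℓ)` ⇒ `Σ ℓ_j θ(a_j) = 0` via the model of an arbitrary lift; res-L1-w45b-stub-2's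
`LetterLift.exists_lift_sum_mul_eq_zero`; `ker_projMap_le_ker_of_eval_eq_zero`.) [OURS · L1 W4.5b · T23-A⁗ (F4) (L2)] -/
theorem exists_letter_model_le_ker
    (s : Spec (.of O) ⟶ Proj (homogeneousSubmodule (Fin (r + 1 + 1)) O))
    (hs : s ≫ (Proj.toSpecZero (homogeneousSubmodule (Fin (r + 1 + 1)) O) ≫
      Spec.map (CommRingCat.ofHom (algebraMap O ((homogeneousSubmodule (Fin (r + 1 + 1)) O) 0)))) = 𝟙 _)
    (x₀ : Proj (homogeneousSubmodule (Fin (r + 1 + 1)) k)) (hsx : s (IsLocalRing.closedPoint O) = Proj.map φ hφ' x₀)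
    (ℓ : MvPolynomial (Fin (r + 1 + 1)) k) (hℓ1 : ℓ.IsHomogeneous 1) (hℓ0 : ℓ ≠ 0) (hx₀ : ℓ ∈ x₀.asHomogeneousIdeal)
    {H : Scheme.{0}} [IsIntegral H] (ι : H ⟶ Proj (homogeneousSubmodule (Fin (r + 1 + 1)) k)) [IsClosedImmersion ι]
    (hH : ¬ Set.range ι ⊆ {y | ℓ ∈ y.asHomogeneousIdeal}) :
    ∃ (c : Fin (r + 1 + 1) → O) (a : Fin (r + 1 + 1))
      (fO : (homogeneousSubmodule (Fin (r + 1 + 1)) O) →+*ᵍ (homogeneousSubmodule (Fin (r + 1)) O))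
      (hfO' : HomogeneousIdeal.irrelevant (homogeneousSubmodule (Fin (r + 1)) O) ≤
        (HomogeneousIdeal.irrelevant (homogeneousSubmodule (Fin (r + 1 + 1)) O)).map fO),
      MvPolynomial.map π (∑ i, C (c i) * X i) = ℓ ∧
      (∀ b : O, fO (C b) = C b) ∧ (∀ j : Fin (r + 1), fO (X (Fin.succAbove a j)) = X j) ∧
      RingHom.ker fO = Ideal.span {∑ i, C (c i) * X i} ∧
      (Proj.map fO hfO').ker.comap (Proj.map φ hφ') =
          vanishingIdeal (⟨closure {y : Proj (homogeneousSubmodule (Fin (r + 1 + 1)) k) | ℓ ∈ y.asHomogeneousIdeal},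
            isClosed_closure⟩ : Closeds (Proj (homogeneousSubmodule (Fin (r + 1 + 1)) k))) ∧
      (∀ z : Proj (homogeneousSubmodule (Fin (r + 1 + 1)) O), (stalkIdeal (Proj.map fO hfO').ker z).IsPrincipal) ∧
      Scheme.IsRegular (Proj.map fO hfO').ker.subscheme ∧
      (𝟙 (Proj (homogeneousSubmodule (Fin (r + 1 + 1)) O)) : _ ⟶ _) ''
          ((Proj.map fO hfO').ker.support : Set (Proj (homogeneousSubmodule (Fin (r + 1 + 1)) O))) ⊆
        {x | ¬ IsGenericPoint x (Set.range (ι ≫ Proj.map φ hφ'))} ∧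
      Flat ((Proj.map fO hfO').ker.subschemeι ≫ 𝟙 _ ≫ (Proj.toSpecZero (homogeneousSubmodule (Fin (r + 1 + 1)) O) ≫
        Spec.map (CommRingCat.ofHom (algebraMap O ((homogeneousSubmodule (Fin (r + 1 + 1)) O) 0))))) ∧
      (Proj.map fO hfO').ker ≤ s.ker := by
  classical
  -- the chart and the coordinates of the section
  obtain ⟨i₀, htop⟩ := exists_chart_of_section s
  obtain ⟨Φ, hΦs, hΦcst⟩ := exists_sectionPull s i₀ htop hs
  let a : Fin (r + 1 + 1) → O := fun j => (Scheme.ΓSpecIso (.of O)).hom (Φ (frac O i₀ j))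
  have ha₀ : IsUnit (a i₀) := by
    change IsUnit ((Scheme.ΓSpecIso (.of O)).hom (Φ (frac O i₀ i₀)))
    rw [coord_self]
    exact isUnit_one
  have hkerπ : RingHom.ker π = IsLocalRing.maximalIdeal O := ker_eq_maximalIdeal_of_surjective π hπ
  -- the coefficients of `ℓ` and an arbitrary lift `c⁰` with a unit coordinate
  let cbar : Fin (r + 1 + 1) → k := fun j => coeff (Finsupp.single j 1) ℓ
  have hℓsum : ℓ = ∑ j, C (cbar j) * X j := Sections.LetterLift.eq_sum_coeff_single_mul_X_of_isHomogeneous_one ℓ hℓ1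
  obtain ⟨j₁, hj₁⟩ : ∃ j₁, cbar j₁ ≠ 0 := by
    by_contra hall
    push Not at hall
    apply hℓ0
    rw [hℓsum]
    exact Finset.sum_eq_zero fun j _ => by rw [hall j, C_0, zero_mul]
  let c0 : Fin (r + 1 + 1) → O := fun j => Function.surjInv hπ (cbar j)
  have hc0 : ∀ j, π (c0 j) = cbar j := fun j => Function.surjInv_eq hπ (cbar j)
  have hunit : ∀ {b : O}, π b ≠ 0 → IsUnit b := fun {b} hb => by
    by_contra hnu
    have hmem : b ∈ IsLocalRing.maximalIdeal O := (IsLocalRing.mem_maximalIdeal b).mpr hnu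
    rw [← hkerπ, RingHom.mem_ker] at hmem
    exact hb hmem
  obtain ⟨u0, hu0⟩ := hunit (b := c0 j₁) (by rw [hc0]; exact hj₁)
  have hmap0 : MvPolynomial.map π (∑ i, C (c0 i) * X i) = ℓ := by
    rw [map_sum]
    simp only [map_mul, map_C, map_X, hc0]
    exact hℓsum.symm
  -- the model of the arbitrary lift: `x₀ ∈ V₊(ℓ)` ⇒ `s(𝔪) ∈ supp Λ⁰` ⇒ `Σ c⁰_j a_j ∈ 𝔪_O`
  obtain ⟨f0, hf0', hf0C, hf0e, hker0, htr0, -, -, -, -⟩ :=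
    exists_hyperplane_model π hπ φ hφ hφ' c0 j₁ (↑u0⁻¹ : O) (by rw [← hu0, Units.mul_inv]) hmap0 ι hH
  have hrel : ∑ j, cbar j * π (a j) = 0 := by
    have hsupp : s (IsLocalRing.closedPoint O) ∈ ((Proj.map f0 hf0').ker.support : Set _) := by
      rw [hsx]
      have h2 : x₀ ∈ (((Proj.map f0 hf0').ker.comap (Proj.map φ hφ')).support : Set _) := by
        rw [htr0, Scheme.IdealSheafData.coe_support_vanishingIdeal]
        exact subset_closure hx₀
      rw [Scheme.IdealSheafData.support_comap] at h2
      exact h2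
    have hmax := eval_mem_maximalIdeal_of_mem_support (Fin.succAbove j₁) f0 hf0' hf0C hf0e s i₀ htop Φ hΦs hΦcst
      (isHomogeneous_sum_C_mul_X_one c0) hker0 hsupp
    rw [← hkerπ, RingHom.mem_ker, map_sum] at hmax
    simp only [map_mul, eval_C, eval_X] at hmax
    rw [map_sum] at hmax
    simp only [map_mul, hc0] at hmax
    exact hmax
  -- stub-2's algebra: a lift `c` of the coefficients with `Σ c_j a_j = 0`
  obtain ⟨c, hc, hca⟩ := Sections.LetterLift.exists_lift_sum_mul_eq_zero π hπ a i₀ ha₀ cbar hrel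
  obtain ⟨u, hu⟩ := hunit (b := c j₁) (by rw [hc]; exact hj₁)
  have hmap : MvPolynomial.map π (∑ i, C (c i) * X i) = ℓ := by
    rw [map_sum]
    simp only [map_mul, map_C, map_X, hc]
    exact hℓsum.symm
  obtain ⟨fO, hfO', hfOC, hfOe, hker, h1, h2, h3, h4, h5⟩ :=
    exists_hyperplane_model π hπ φ hφ hφ' c j₁ (↑u⁻¹ : O) (by rw [← hu, Units.mul_inv]) hmap ι hH
  have heval : MvPolynomial.eval a (∑ i, C (c i) * X i) = 0 := by
    rw [map_sum]
    simp only [map_mul, eval_C, eval_X]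
    exact hca
  exact ⟨c, j₁, fO, hfO', hmap, hfOC, hfOe, hker, h1, h2, h3, h4, h5,
    ker_projMap_le_ker_of_eval_eq_zero (Fin.succAbove j₁) fO hfO' hfOC hfOe s i₀ htop Φ hΦs hΦcst
      (isHomogeneous_sum_C_mul_X_one c) hker heval⟩

end Main

end LinearLetter

end Summit.ResolutionOfSingularities.ResolutionOfSingularities.Cruxes.EquisingularLiftNat

end
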